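import Literature.Barriers.CriticalPhenomena.SupercriticalSAWSpaceFilling
import Mathlib.Analysis.SpecialFunctions.Pow.Real
import HarnessLib

/-!
# Supercritical self-avoiding walks are space-filling (Duminil-Copin–Kozma–Yadin 2014):
# the steps of the printed proof of Theorem 1, and Theorem 1 from Theorem 6

Companion of `Literature/Barriers/CriticalPhenomena/SupercriticalSAWSpaceFilling.lean`, which
vendors Theorem 1 of H. Duminil-Copin, G. Kozma, A. Yadin, *Supercritical self-avoiding walks are
space-filling*, Ann. IHP Probab. Stat. 50 (2014) 315–326 (arXiv:1110.3074) as the named fact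
`SupercriticalSAW.DKY2014_thm1` over the library's objects (`lawAt x`, `unitDisk`,
`IsClosestSite`, `tube`, `holeGraph`, `HasLargeHole`). The theorem is a genuine piece of
rigorous statistical mechanics (its printed proof is the whole paper: Hammersley–Welsh bridges,
Lemma 5, Proposition 3, Proposition 7, Theorem 6); this file records the proof DAG as named
facts over the SAME objects and proves what is bookkeeping: the geometry of the discretised
disk `𝔻_δ` and the final step "Theorem 1 given Theorem 6".

## What the source prints (§3 "Proof of the main results")

* "To simplify the picture, we will assume that all our boxes have their lower left corner in
  `(2m+2)δℤ²`. When `Ω_δ` is fixed, such boxes included in `Ω_δ` are called `m`-boxes and the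
  set of `m`-boxes is denoted by `𝓕(Ω_δ, m)`."
* **Theorem 6.** "For every `x > 1/μ`, there exists `m = m(x)` and `c(x) > 0` such that for
  every domain `Ω` and every `δ > 0` such that `𝓕(Ω_δ, m)` is connected, one has, for every `a`
  and `b` in the boundary of `Ω`, and every `λ > 0`,
  `P_{Ω_δ,a_δ,b_δ,x}(∃ a component of Ω_δ ∖ Γ_δ^{6m} of size > λ) ≤ (C(x,Ω)/δ²) e^{-c(x)λ}`."
* **Theorem 1 given Theorem 6.** "Here our domain is `𝔻`. Clearly, the family of all boxes in
  `𝔻_δ` is connected (it is an interval in every row and every column), hence Theorem 6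
  applies. Taking `λ = C₁ log(1/δ)` for `C₁` sufficiently large gives the result."
* **Proposition 7.** "Let `(Ω,a,b)` be a domain with two points on the boundary. Fix `δ > 0`
  and `m ∈ ℕ` and assume `𝓕(Ω_δ,m)` is connected. Then there exists `C(x,m) < ∞` such that
  for every `F ∈ 𝓕(Ω_δ,m)`, `P_{(Ω_δ,a_δ,b_δ,x)}(bdist(γ_δ, V_F) = 1) ≤ C(x,m) Z_m(x)^{-|F|}`"
  (proof: Claim `Z_F(x) ≥ Z_m(x)^{|F|}` by induction on `|F|`; a link polygon `ℓ(γ)` of length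
  `≤ 100m`; the map `f(γ₁,γ₂) = γ₁ Δ ℓ(γ₁) Δ γ₂`, at most `4^{100m}`-to-one, whence
  `Z_{Θ_F}(x) Z_F(x) ≤ 4^{100m} max(x⁶, x^{-100m+4}) Z_{(Ω_δ,a_δ,b_δ)}(x)`).
* Proof of Theorem 6 in dimension 2: `A_n ≤ λⁿ` (connected subsets of `ℤ²` containing `0`,
  Grimmett, *Percolation*, Thm. 4.20); choose `m` with `Z_m(x) > 2λ` (Proposition 3); a
  connected set `S` of cardinality `s` at distance `> 6m` from `γ_δ` is covered by a maximal
  connected family of `≥ s/(2m+1)²` untouched `m`-boxes at box-distance `1` from `γ_δ`; a union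
  bound over the `≤ (C(Ω)/δ²) λ^K` connected families of `K` boxes gives
  `P[𝒜(s)] ≤ (C(x,m,Ω)/δ²) 2^{-s/(2m+1)²}`.

## The proof DAG of `DKY2014_thm1` (provefact decomposition; what is proved is marked)

* `Literature.Probability.RandomPlanarGeometry.SAW.DKY2014_eq21` (Hammersley–Welsh bridges, eq. (2.1)) → `Literature.Probability.RandomPlanarGeometry.SAW.DKY2014_lem5`
  (Lemma 5) → `Literature.Probability.RandomPlanarGeometry.SAW.DKY2014_prop3` (Proposition 3): named facts of
  `Literature/Probability/RandomPlanarGeometry/SupercriticalSAWPolygons.lean` (with `P_m`,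
  `Z_m(x)`, `m`-boxes `mBox`, `V_F = boxVertices`, `IsConnectedFamily`).
* Proposition 7 for `Ω = 𝔻` and Proposition 3, with the lattice-animal bound
  `Literature.Probability.LatticeModels.card_connectedFamily_le`
  (`Literature/Probability/LatticeModels/LatticeAnimals.lean`), give `DKY2014_thm6_disk`
  (Theorem 6 for `Ω = 𝔻`, named fact below) — DISCHARGED since: `DKY2014_thm6_disk_holds`
  (`SupercriticalSAWSpaceFillingTilesTheorem6.lean`, the tile form of Proposition 7 with margin
  `r = 4` and a separate annular sum, over `…TilesDeep/…/TilesUnion`), the conditional `m`-box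
  route being `DKY2014_thm6_disk_of_facts` (`…Peierls.lean`); Proposition 3 itself is proved
  (`Literature.Probability.RandomPlanarGeometry.SAW.DKY2014_prop3_holds`), so `DKY2014_thm1_holds`
  and `SupercriticalSAWSpaceFilling_holds` are unconditional.
* PROVED here: `DKY2014_thm1_of_thm6_disk : DKY2014_thm6_disk → DKY2014_thm1` (the printed
  paragraph "Theorem 1 given Theorem 6", with `λ = (3/c) log(1/δ)`, the bound being `C δ → 0`),
  and the disk geometry it and the later steps need: `𝔻_δ = meshDomain unitDisk δ` is ALL of
  `𝔻 ∩ δℤ²` (`meshDomain_unitDisk`: the mesh vertex graph of the disk is connected, by monotone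
  lattice paths to the origin inside the convex disk), `discreteDomainGraph unitDisk δ` is `ℤ²`
  restricted to it (`discreteDomainGraph_unitDisk_adj`), and the closest sites `a_δ, b_δ` lie
  within `3δ` of `a, b` (`IsClosestSite.dist_le`), hence are distinct for `6δ < |a - b|`
  (`IsClosestSite.ne`).

## Design choices (deviations from print in the vendored intermediate facts)

* `DKY2014_thm6_disk` is the instance `Ω = 𝔻` of Theorem 6 in the form consumed by Theorem 1:
  the tube radius `6m(x)` is an existential `ξ(x) > 0`; `a ≠ b` is explicit and the mesh is
  restricted to `0 < δ < δ₀(x,a,b)` — for `a_δ = b_δ` the only self-avoiding walk is the trivial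
  one, `𝔻_δ ∖ Γ_δ^ξ` is then one large component and the printed bound `(C/δ²) e^{-cλ}` fails
  for `λ ≍ δ^{-2}`, so the print tacitly takes `δ` small (given `a ≠ b`); `λ` is called `s`.
  Probabilities are values of the measure `lawAt x unitDisk δ a_δ b_δ` in `ℝ≥0∞`, bounds are
  `ENNReal.ofReal`.

## Audits (D-0021 barrier-audit)

* 2026-08-15 (gen 1): CONFIRMED at page level (Theorem 6 and "Theorem 1 given Theorem 6", §3
  p. 6 of arXiv:1110.3074); the printed GENERAL-domain Theorem 6 is false as literally stated
  (dangling filaments: `SupercriticalSAWSpaceFillingFilaments.lean`,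
  `…FilamentsCusp.lean`, `…FilamentsCuspCharitable.lean`), the disk instance vendored here is
  proved; the technique class is narrowed to δ-independent fugacity neighbourhoods
  (`SupercriticalSAWSpaceFillingNarrow.lean`).
* 2026-08-15 (gen 2): CONFIRMED again and SHARPENED (`SupercriticalSAWSpaceFillingStepsNarrow.lean`,
  all proved): supercriticality enters Theorem 6 only through Proposition 3 — "choosing `m` large
  enough (or equivalently `Z_m(x)` large enough)" (§3, p. 6), the proof using `x > 1/μ` solely in
  "some `m = m(x,2)` such that `Z_m(x) > 2λ`" (p. 7) — so the fact below holds in the EFFECTIVE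
  form `DKY2014_thm6_disk_effective`: at every fugacity `x > 0` and every box scale `m` with
  `x^{18} Z_m(x) ≥ 1600`, with tube radius `28m + 224` and mesh threshold `≤ (9m+75)⁻²`;
  consequences: `not_sawScalingLimitAt_of_Zbox` (no SLE_{8/3} on the whole criterion set,
  unconditional), the schedule form `not_sawScalingLimitAlong_of_Zbox_schedule` (explicit reach
  into near-critical windows: as far as certified scales exist, the growth of
  `m*(x) = min{m : x^{18} Z_m(x) ≥ 1600}` as `x ↓ x_c` being what the source calls "probably no
  easier than the SLE_{8/3} conjecture", p. 5), and the enumerative necessary condition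
  `Zbox_lt_of_sawScalingLimit : SAWScalingLimit → ∀ m, x_c^{18} Z_m(x_c) < 1600` (also from a
  YES to Problem 10, `Zbox_lt_of_DKY2014_problem10_disk`).
-/

noncomputable section

open MeasureTheory Filter Topology Literature.Probability.LatticeModels Literature.Probability.Percolation Literature.Probability.RandomPlanarGeometry.SAW
open scoped ENNReal NNReal

namespace Literature.Barriers.CriticalPhenomena

namespace SupercriticalSAW

/-! ### The discretised unit disk `𝔻_δ` -/

/-- The squared norm of a mesh point. [folklore] -/
theorem norm_meshPoint_sq (δ : ℝ) (v : Site 2) :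
    ‖meshPoint δ v‖ ^ 2 = δ ^ 2 * ∑ j, ((v j : ℤ) : ℝ) ^ 2 := by
  rw [Complex.sq_norm, Complex.normSq_apply, meshPoint_re, meshPoint_im, Fin.sum_univ_two]
  ring

/-- The mesh vertices of the unit disk are the sites whose mesh point has norm `< 1`.
[cite: DuminilCopinKozmaYadin2014, §1 (Ω_δ = Ω ∩ δℤ²)] -/
theorem mem_meshVertices_unitDisk {δ : ℝ} {v : Site 2} :
    v ∈ meshVertices unitDisk δ ↔ ‖meshPoint δ v‖ < 1 := by
  rw [mem_meshVertices_iff, unitDisk, mem_ball_zero_iff]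

/-- The mesh vertices of the unit disk in coordinates: `δ² (v₀² + v₁²) < 1`. [folklore] -/
theorem mem_meshVertices_unitDisk_iff_sq {δ : ℝ} {v : Site 2} :
    v ∈ meshVertices unitDisk δ ↔ δ ^ 2 * ∑ j, ((v j : ℤ) : ℝ) ^ 2 < 1 := by
  rw [mem_meshVertices_unitDisk, ← norm_meshPoint_sq, sq_lt_one_iff₀ (norm_nonneg _)]

/-- The origin is a mesh vertex of the unit disk. [folklore] -/
theorem zero_mem_meshVertices_unitDisk (δ : ℝ) : (0 : Site 2) ∈ meshVertices unitDisk δ := by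
  rw [mem_meshVertices_unitDisk_iff_sq]; norm_num

/-- Two nearest neighbours of `ℤ²` whose mesh points lie in the open unit disk are joined in the
mesh graph of the disk (the closed disk is convex). [folklore] -/
theorem meshGraph_unitDisk_adj_of_zdGraph_adj {δ : ℝ} {u v : Site 2}
    (hu : u ∈ meshVertices unitDisk δ) (hv : v ∈ meshVertices unitDisk δ)
    (h : (zdGraph 2).Adj u v) : (meshGraph unitDisk δ).Adj u v := by
  refine meshGraph_adj_iff.2 ⟨h, ?_⟩
  rw [unitDisk, closure_ball (0 : ℂ) one_ne_zero]
  rw [mem_meshVertices_iff, unitDisk] at hu hv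
  exact (convex_closedBall (0 : ℂ) 1).segment_subset (Metric.ball_subset_closedBall hu)
    (Metric.ball_subset_closedBall hv)

/-- A site whose coordinates are no larger in absolute value than those of a mesh vertex of the
disk is a mesh vertex of the disk. [folklore] -/
theorem mem_meshVertices_unitDisk_of_sq_le {δ : ℝ} {u v : Site 2}
    (hu : u ∈ meshVertices unitDisk δ)
    (h : ∑ j, ((v j : ℤ) : ℝ) ^ 2 ≤ ∑ j, ((u j : ℤ) : ℝ) ^ 2) :
    v ∈ meshVertices unitDisk δ := by
  rw [mem_meshVertices_unitDisk_iff_sq] at hu ⊢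
  exact lt_of_le_of_lt (mul_le_mul_of_nonneg_left h (sq_nonneg δ)) hu

/-- One step towards the origin: from a site `v` with `v i ≠ 0`, the site `w` obtained by moving
the `i`-th coordinate of `v` by one towards `0` is a `ℤ²`-neighbour with smaller coordinates.
[folklore] -/
theorem exists_step_towards_zero (v : Site 2) (i : Fin 2) (hi : v i ≠ 0) :
    ∃ w : Site 2, (zdGraph 2).Adj v w ∧ (w i).natAbs + 1 = (v i).natAbs ∧
      ∀ j, j ≠ i → w j = v j := by
  rcases lt_or_gt_of_ne hi with hneg | hpos
  · refine ⟨v + Pi.single i 1, (zdGraph_adj_iff _ _).2 ⟨i, Or.inl rfl⟩, ?_, fun j hj => by simp [hj]⟩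
    simp only [Pi.add_apply, Pi.single_eq_same]
    omega
  · refine ⟨v - Pi.single i 1, (zdGraph_adj_iff _ _).2 ⟨i, Or.inr (by simp)⟩, ?_,
      fun j hj => by simp [hj]⟩
    simp only [Pi.sub_apply, Pi.single_eq_same]
    omega

/-- Every mesh vertex of the unit disk is joined to the origin inside the mesh vertex graph
(monotone lattice path towards `0`). [folklore] -/
theorem meshVertexGraph_unitDisk_reachable_zero {δ : ℝ} (v : Site 2)
    (hv : v ∈ meshVertices unitDisk δ) :
    (meshVertexGraph unitDisk δ).Reachable ⟨v, hv⟩ ⟨0, zero_mem_meshVertices_unitDisk δ⟩ := by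
  suffices key : ∀ n : ℕ, ∀ (v : Site 2) (hv : v ∈ meshVertices unitDisk δ),
      ∑ j, (v j).natAbs = n →
      (meshVertexGraph unitDisk δ).Reachable ⟨v, hv⟩ ⟨0, zero_mem_meshVertices_unitDisk δ⟩ from
    key _ v hv rfl
  intro n
  induction n with
  | zero =>
    intro v hv hn
    have : v = 0 := by
      funext i
      have := Finset.sum_eq_zero_iff.1 hn i (Finset.mem_univ i)
      exact Int.natAbs_eq_zero.1 this
    subst this
    rfl
  | succ n ih =>
    intro v hv hn
    -- pick a non-zero coordinate `i` and move it one step towards `0`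
    obtain ⟨i, hi⟩ : ∃ i : Fin 2, v i ≠ 0 := by
      by_contra hcon
      push Not at hcon
      have : ∑ j, (v j).natAbs = 0 := Finset.sum_eq_zero fun j _ => by simp [hcon j]
      omega
    obtain ⟨w, hadj, habs, hwj⟩ := exists_step_towards_zero v i hi
    have hterm : ∀ j, ((w j : ℤ) : ℝ) ^ 2 ≤ ((v j : ℤ) : ℝ) ^ 2 ∧ (w j).natAbs ≤ (v j).natAbs := by
      intro j
      by_cases hj : j = i
      · subst hj
        refine ⟨?_, by omega⟩
        have h1 : ((w j).natAbs : ℤ) ≤ (v j).natAbs := by omega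
        have h2 : |w j| ≤ |v j| := by simpa [Int.natCast_natAbs] using h1
        have h3 : |((w j : ℤ) : ℝ)| ≤ |((v j : ℤ) : ℝ)| := by exact_mod_cast h2
        exact sq_le_sq.2 h3
      · rw [hwj j hj]; exact ⟨le_rfl, le_rfl⟩
    have hwmem : w ∈ meshVertices unitDisk δ :=
      mem_meshVertices_unitDisk_of_sq_le hv (Finset.sum_le_sum fun j _ => (hterm j).1)
    have hn' : ∑ j, (w j).natAbs = n := by
      have hsum : ∑ j, (w j).natAbs + 1 = ∑ j, (v j).natAbs := by
        rw [Fin.sum_univ_two, Fin.sum_univ_two]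
        fin_cases i
        · have h1 := hwj 1 (by decide)
          simp only [Fin.zero_eta] at habs
          rw [h1]; omega
        · have h0 := hwj 0 (by decide)
          simp only [Fin.mk_one] at habs
          rw [h0]; omega
      omega
    have hadj' : (meshVertexGraph unitDisk δ).Adj ⟨v, hv⟩ ⟨w, hwmem⟩ :=
      SimpleGraph.induce_adj.2 (meshGraph_unitDisk_adj_of_zdGraph_adj hv hwmem hadj)
    exact hadj'.reachable.trans (ih w hwmem hn')


/-- The mesh vertex graph of the unit disk is preconnected. [folklore] -/
theorem meshVertexGraph_unitDisk_preconnected (δ : ℝ) :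
    (meshVertexGraph unitDisk δ).Preconnected := fun u v =>
  (meshVertexGraph_unitDisk_reachable_zero u.1 u.2).trans
    (meshVertexGraph_unitDisk_reachable_zero v.1 v.2).symm

/-- For the unit disk the discrete domain `𝔻_δ` ("the largest connected component of
`𝔻 ∩ δℤ²`") is all of `𝔻 ∩ δℤ²`: the sites at distance `< 1/δ` from the origin.
[cite: DuminilCopinKozmaYadin2014, §1 and Theorem 1] -/
theorem meshDomain_unitDisk (δ : ℝ) : meshDomain unitDisk δ = meshVertices unitDisk δ := by
  refine Set.Subset.antisymm (meshDomain_subset_meshVertices _ _) fun v hv => ?_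
  have hsub := (meshVertexGraph_unitDisk_preconnected δ).subsingleton_connectedComponent
  simp only [meshDomain, Set.mem_iUnion, Set.mem_image]
  refine ⟨(meshVertexGraph unitDisk δ).connectedComponentMk ⟨v, hv⟩, fun C' => ?_, ⟨v, hv⟩,
    ?_, rfl⟩
  · rw [Subsingleton.elim C' ((meshVertexGraph unitDisk δ).connectedComponentMk ⟨v, hv⟩)]
  · rw [SimpleGraph.ConnectedComponent.mem_supp_iff]

/-- Membership in `𝔻_δ`: `‖δ v‖ < 1`. [cite: DuminilCopinKozmaYadin2014, §1 and Theorem 1] -/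
theorem mem_meshDomain_unitDisk {δ : ℝ} {v : Site 2} :
    v ∈ meshDomain unitDisk δ ↔ ‖meshPoint δ v‖ < 1 := by
  rw [meshDomain_unitDisk, mem_meshVertices_unitDisk]

/-- The graph `𝔻_δ` is the nearest-neighbour graph `ℤ²` restricted to the sites of the disk.
[cite: DuminilCopinKozmaYadin2014, §1 and Theorem 1] -/
theorem discreteDomainGraph_unitDisk_adj {δ : ℝ} {u v : Site 2} :
    (discreteDomainGraph unitDisk δ).Adj u v ↔
      (zdGraph 2).Adj u v ∧ u ∈ meshDomain unitDisk δ ∧ v ∈ meshDomain unitDisk δ := by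
  rw [discreteDomainGraph_adj_iff]
  constructor
  · rintro ⟨h, hu, hv⟩
    exact ⟨meshGraph_le_zdGraph _ _ h, hu, hv⟩
  · rintro ⟨h, hu, hv⟩
    rw [meshDomain_unitDisk] at hu hv
    exact ⟨meshGraph_unitDisk_adj_of_zdGraph_adj hu hv h, (meshDomain_unitDisk δ).symm ▸ hu,
      (meshDomain_unitDisk δ).symm ▸ hv⟩

/-! ### The closest sites `a_δ, b_δ` -/

/-- A site of `𝔻_δ` closest to a boundary point `z` of the disk is within `3δ` of `z`
(for `0 < δ ≤ 1/4`). [cite: DuminilCopinKozmaYadin2014, §1 (a_δ, b_δ)] -/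
theorem IsClosestSite.dist_le {δ : ℝ} (hδ : 0 < δ) (hδ' : δ ≤ 1 / 4) {z : ℂ} (hz : ‖z‖ = 1)
    {w : Site 2} (hw : IsClosestSite unitDisk δ z w) : dist (meshPoint δ w) z ≤ 3 * δ := by
  -- the lattice site nearest to the interior point `y = (1 - 2δ) z` lies in `𝔻_δ`
  set y : ℂ := ((1 - 2 * δ : ℝ) : ℂ) * z with hy
  have hy_norm : ‖y‖ = 1 - 2 * δ := by
    rw [hy, norm_mul, Complex.norm_real, hz, mul_one, Real.norm_eq_abs, abs_of_nonneg (by linarith)]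
  have hyz : dist y z = 2 * δ := by
    rw [dist_eq_norm, hy]
    have : ((1 - 2 * δ : ℝ) : ℂ) * z - z = ((-(2 * δ) : ℝ) : ℂ) * z := by push_cast; ring
    rw [this, norm_mul, Complex.norm_real, hz, mul_one, Real.norm_eq_abs, abs_neg,
      abs_of_nonneg (by linarith)]
  have hnear := dist_meshPoint_nearestSite_le hδ y
  have hmem : nearestSite δ y ∈ meshDomain unitDisk δ := by
    rw [mem_meshDomain_unitDisk]
    calc ‖meshPoint δ (nearestSite δ y)‖ ≤ ‖y‖ + dist (meshPoint δ (nearestSite δ y)) y := by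
          rw [dist_eq_norm]
          exact norm_le_insert' _ _ |>.trans_eq (by ring)
      _ ≤ 1 - 2 * δ + δ := by rw [hy_norm]; linarith
      _ < 1 := by linarith
  calc dist (meshPoint δ w) z ≤ dist (meshPoint δ (nearestSite δ y)) z := hw.2 _ hmem
    _ ≤ dist (meshPoint δ (nearestSite δ y)) y + dist y z := dist_triangle _ _ _
    _ ≤ δ + 2 * δ := add_le_add hnear hyz.le
    _ = 3 * δ := by ring

/-- Closest sites to two distinct boundary points are distinct once `6δ < |a - b|`.
[cite: DuminilCopinKozmaYadin2014, §1 (a_δ, b_δ)] -/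
theorem IsClosestSite.ne {δ : ℝ} (hδ : 0 < δ) (hδ' : δ ≤ 1 / 4) {a b : ℂ} (ha : ‖a‖ = 1)
    (hb : ‖b‖ = 1) (hab : 6 * δ < dist a b) {u v : Site 2} (hu : IsClosestSite unitDisk δ a u)
    (hv : IsClosestSite unitDisk δ b v) : u ≠ v := by
  rintro rfl
  have h1 := hu.dist_le hδ hδ' ha
  have h2 := hv.dist_le hδ hδ' hb
  have := dist_triangle_left a b (meshPoint δ u)
  linarith


/-! ### Theorem 6 of the source for the unit disk, and Theorem 1 from it -/

/-- **Theorem 6 of Duminil-Copin–Kozma–Yadin 2014, instance `Ω = 𝔻`** (named fact — the node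
of the printed proof from which Theorem 1 follows; its own printed proof is Proposition 3,
Proposition 7 and the Peierls sum of §3): "For every `x > 1/μ`, there exists `m = m(x)` and
`c(x) > 0` such that for every domain `Ω` and every `δ > 0` such that `𝓕(Ω_δ, m)` is connected,
one has, for every `a` and `b` in the boundary of `Ω`, and every `λ > 0`,
`P_{Ω_δ,a_δ,b_δ,x}(∃ a component of Ω_δ ∖ Γ_δ^{6m} of size > λ) ≤ (C(x,Ω)/δ²) e^{-c(x)λ}`", and
"Here our domain is `𝔻`. Clearly, the family of all boxes in `𝔻_δ` is connected (it is an
interval in every row and every column), hence Theorem 6 applies." Vendored for `Ω = 𝔻` over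
the objects of `DKY2014_thm1` (`lawAt`, `IsClosestSite`, `HasLargeHole`), with: the tube radius
`6m(x)` recorded as an existential `ξ = ξ(x) > 0`; `a ≠ b` explicit and the mesh restricted to
`0 < δ < δ₀(x, a, b)` (for `a_δ = b_δ` the only walk is trivial and the printed bound fails, so
the print implicitly takes `δ` small); `λ` is called `s`. PROVED: `DKY2014_thm6_disk_holds`
(`…TilesTheorem6.lean`); effective form with the box scale free and `x > 0` arbitrary:
`DKY2014_thm6_disk_effective` (`…StepsNarrow.lean`). [cite: DuminilCopinKozmaYadin2014, Theorem 6] -/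
def DKY2014_thm6_disk : Prop :=
  ∀ x : ℝ, criticalFugacity < x →
    ∃ ξ : ℝ, 0 < ξ ∧ ∃ c : ℝ, 0 < c ∧ ∃ C : ℝ,
      ∀ a b : ℂ, ‖a‖ = 1 → ‖b‖ = 1 → a ≠ b →
        ∃ δ₀ : ℝ, 0 < δ₀ ∧ ∀ δ : ℝ, 0 < δ → δ < δ₀ →
          ∀ u v : Site 2, IsClosestSite unitDisk δ a u → IsClosestSite unitDisk δ b v →
            ∀ s : ℝ, 0 < s →
              lawAt x unitDisk δ u v {γ | HasLargeHole ξ s γ} ≤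
                ENNReal.ofReal (C / δ ^ 2 * Real.exp (-(c * s)))

/-- The arithmetic of "taking `λ = C₁ log(1/δ)` for `C₁` sufficiently large": with `C₁ = 3/c`,
`(C/δ²) e^{-c λ} = C δ`. [cite: DuminilCopinKozmaYadin2014, §3 (proof of Theorem 1 given Theorem 6)] -/
theorem peierls_bound_at_log {C c δ : ℝ} (hc : 0 < c) (hδ : 0 < δ) :
    C / δ ^ 2 * Real.exp (-(c * (3 / c * Real.log (1 / δ)))) = C * δ := by
  have h3 : c * (3 / c * Real.log (1 / δ)) = -(Real.log δ * 3) := by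
    rw [one_div, Real.log_inv]; field_simp
  rw [h3, neg_neg, ← Real.rpow_def_of_pos hδ, show (3 : ℝ) = ((3 : ℕ) : ℝ) by norm_num,
    Real.rpow_natCast]
  field_simp

/-- **Theorem 1 from Theorem 6** ("Theorem 1 given Theorem 6. Here our domain is `𝔻` … Taking
`λ = C₁ log(1/δ)` for `C₁` sufficiently large gives the result"): the disk instance of
Theorem 6 implies `DKY2014_thm1`, with `ξ(x)` that of Theorem 6 and `c = 3/c(x)`, the
probability of a hole larger than `c log(1/δ)` being at most `C δ → 0`.
[cite: DuminilCopinKozmaYadin2014, §3 (proof of Theorem 1 given Theorem 6)] -/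
theorem DKY2014_thm1_of_thm6_disk (h : DKY2014_thm6_disk) : DKY2014_thm1 := by
  intro a b ha hb hab x hx
  obtain ⟨ξ, hξ, c, hc, C, h⟩ := h x hx
  obtain ⟨δ₀, hδ₀, h⟩ := h a b ha hb hab
  refine ⟨ξ, hξ, 3 / c, by positivity, fun A B hAB => ?_⟩
  -- for `0 < δ < min δ₀ 1` the probability is at most `C δ`
  have hbound : ∀ δ : ℝ, 0 < δ → δ < min δ₀ 1 →
      lawAt x unitDisk δ (A δ) (B δ) {γ | HasLargeHole ξ (3 / c * Real.log (1 / δ)) γ} ≤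
        ENNReal.ofReal (C * δ) := by
    intro δ hδ hδ1
    have hδ₀' : δ < δ₀ := lt_of_lt_of_le hδ1 (min_le_left _ _)
    have hδ1' : δ < 1 := lt_of_lt_of_le hδ1 (min_le_right _ _)
    have hs : 0 < 3 / c * Real.log (1 / δ) := by
      have : 0 < Real.log (1 / δ) := Real.log_pos (by rw [lt_div_iff₀ hδ]; linarith)
      positivity
    have := h δ hδ hδ₀' (A δ) (B δ) (hAB δ hδ).1 (hAB δ hδ).2 _ hs
    rwa [peierls_bound_at_log hc hδ] at this
  have hupper : Tendsto (fun δ : ℝ => ENNReal.ofReal (C * δ)) (𝓝[>] 0) (𝓝 0) := by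
    have : Tendsto (fun δ : ℝ => C * δ) (𝓝 0) (𝓝 (C * 0)) :=
      (continuous_const.mul continuous_id).tendsto 0
    rw [mul_zero] at this
    simpa using (ENNReal.tendsto_ofReal this).mono_left nhdsWithin_le_nhds
  refine tendsto_of_tendsto_of_tendsto_of_le_of_le' tendsto_const_nhds hupper
    (Eventually.of_forall fun δ => zero_le) ?_
  filter_upwards [Ioo_mem_nhdsGT (lt_min hδ₀ one_pos)] with δ hδ
  exact hbound δ hδ.1 hδ.2

end SupercriticalSAW

end Literature.Barriers.CriticalPhenomena
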